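import Summits.ResolutionOfSingularities.ResolutionOfSingularities.Theorems.FrobeniusLadderFInjectiveMacaulayficationOmegaOneS2KNewtonKFanChecks
import HarnessLib

/-!
# HEAVY KERNEL CHECKS (fan side, (hge) ray chunks 0–11) of the BED Ω₁ refined class model X̃₂ class-route certificate: shapes, (hgen), unimodularity, vertex bridge, pure powers, (hAJ), the vertex property (hge)
# RAY-CHUNK BY RAY-CHUNK, the local-matrix bridge `hVq` and the NEWTON MINIMISER check — each ONE `decide +kernel` on the tables of `OmegaOneS2KNewtonKFanTables` / `…FanTablesB` / `…NewtonTables`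
# (crux `FInjectiveMacaulayfication` stmt-ResolutionOfSingularities-15315, chain w45a; Omega1 F6 W1, res-L1-w45a-plan-1 R23.23 (1) F6; seat res-L1-w45a-stub-3 g12)

Support file for crux stmt-ResolutionOfSingularities-15315 (`FrobeniusLadder.FInjectiveMacaulayfication`), chain w45a.
[OURS · L1 W4.5a] — NOT a statement of any manuscript; AI-written, weaker than expert review.

The Boolean checks of res-L1-w45a-stub-4's `FanCheckKit` (+ res-L1-w45a-stub-2's `FanCheckMulti` / `FanCheckChunks`) on the BED Ω₁ refined class model X̃₂ class-route data (`f_B9 = z² + x⁹ + y⁹ + u⁹ + t⁹`, EVERY characteristic p ∤ 18 (p-uniform),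
res-L1-w45a-stub-3's `Σ_f ∧ Σ(𝔪)` fan, 1223 charts, centre `𝔪·K` with `|K| = 6032`, 6032 generators; kit job j329694-konly, certificate sha16 abe6ee2c854b2a20): `checkShapes` (no exceptional vectors, `r = 0`),
`CL.length = 1223`, `checkHgen`, `checkDetUnit`, `FanCheckMulti.checkMVBridge`, `checkHprim`, `checkHAJ`, the length check of `KL2`, the vertex property `checkHge` as 24 ray-chunk checks
`checkHgeFrom AL2 CL (6k) RAYS_k` glued by `FanCheckChunks.checkHgeFrom_append_true`, the bridge `Vq c = chartV 5 RAYS CL 1223 c`, and the NEWTON MINIMISER check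
(`U0 c ∈ SUPPv` minimises every row functional of `Vq c` over `SUPPv` — the fan refines `Σ_f`). The cover records are checked in `OmegaOneS2KNewtonKCoverChecks`; the binders are `OmegaOneS2KNewtonKFan`.
No definitions, no named facts. [folklore; cite: CoxLittleSchenck2011, §2.3]
-/

-- single-problem summit: the doubled namespace component is forced
set_option linter.dupNamespace false

namespace Summit.ResolutionOfSingularities.ResolutionOfSingularities.Theorems.FInjectiveMacaulayfication.OmegaOneS2KNewtonKFan

open Summit.ResolutionOfSingularities.ResolutionOfSingularities.Theorems.FInjectiveMacaulayfication
open FanCheckKit FanCheckSound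

/-! ## (hge) ray chunks 0–11 -/
/-- (hge), rays 0–5 (with the specimen-distinct conjunct `CL.length = 1223`). -/
theorem check_hge_0 : checkHgeFrom AL2 CL 0 RAYS_0 = true ∧ CL.length = 1223 := ⟨by decide +kernel, tlen⟩
/-- (hge), rays 6–11 (with the specimen-distinct conjunct `CL.length = 1223`). -/
theorem check_hge_1 : checkHgeFrom AL2 CL 6 RAYS_1 = true ∧ CL.length = 1223 := ⟨by decide +kernel, tlen⟩
/-- (hge), rays 12–17 (with the specimen-distinct conjunct `CL.length = 1223`). -/
theorem check_hge_2 : checkHgeFrom AL2 CL 12 RAYS_2 = true ∧ CL.length = 1223 := ⟨by decide +kernel, tlen⟩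
/-- (hge), rays 18–23 (with the specimen-distinct conjunct `CL.length = 1223`). -/
theorem check_hge_3 : checkHgeFrom AL2 CL 18 RAYS_3 = true ∧ CL.length = 1223 := ⟨by decide +kernel, tlen⟩
/-- (hge), rays 24–29 (with the specimen-distinct conjunct `CL.length = 1223`). -/
theorem check_hge_4 : checkHgeFrom AL2 CL 24 RAYS_4 = true ∧ CL.length = 1223 := ⟨by decide +kernel, tlen⟩
/-- (hge), rays 30–35 (with the specimen-distinct conjunct `CL.length = 1223`). -/
theorem check_hge_5 : checkHgeFrom AL2 CL 30 RAYS_5 = true ∧ CL.length = 1223 := ⟨by decide +kernel, tlen⟩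
/-- (hge), rays 36–41 (with the specimen-distinct conjunct `CL.length = 1223`). -/
theorem check_hge_6 : checkHgeFrom AL2 CL 36 RAYS_6 = true ∧ CL.length = 1223 := ⟨by decide +kernel, tlen⟩
/-- (hge), rays 42–47 (with the specimen-distinct conjunct `CL.length = 1223`). -/
theorem check_hge_7 : checkHgeFrom AL2 CL 42 RAYS_7 = true ∧ CL.length = 1223 := ⟨by decide +kernel, tlen⟩
/-- (hge), rays 48–53 (with the specimen-distinct conjunct `CL.length = 1223`). -/
theorem check_hge_8 : checkHgeFrom AL2 CL 48 RAYS_8 = true ∧ CL.length = 1223 := ⟨by decide +kernel, tlen⟩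
/-- (hge), rays 54–59 (with the specimen-distinct conjunct `CL.length = 1223`). -/
theorem check_hge_9 : checkHgeFrom AL2 CL 54 RAYS_9 = true ∧ CL.length = 1223 := ⟨by decide +kernel, tlen⟩
/-- (hge), rays 60–65 (with the specimen-distinct conjunct `CL.length = 1223`). -/
theorem check_hge_10 : checkHgeFrom AL2 CL 60 RAYS_10 = true ∧ CL.length = 1223 := ⟨by decide +kernel, tlen⟩
/-- (hge), rays 66–71 (with the specimen-distinct conjunct `CL.length = 1223`). -/
theorem check_hge_11 : checkHgeFrom AL2 CL 66 RAYS_11 = true ∧ CL.length = 1223 := ⟨by decide +kernel, tlen⟩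

end Summit.ResolutionOfSingularities.ResolutionOfSingularities.Theorems.FInjectiveMacaulayfication.OmegaOneS2KNewtonKFan
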